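import Literature.IUT.HodgeArakelov.BadPrimeGaussianMonoidsSyncProofs
import Literature.IUT.HodgeArakelov.CohomologyLimitConj

/-!
# [IUTchII] Cor 3.5 (ii) "⥤": the junction hypothesis `hfix` ("the `D^δ_{t,μ_-}`-sections FIX the class `θ`")
# DISCHARGED at the continuous-cohomology model `lim_K H¹(Π_Ÿ|_K, −)` (proof-only sequel to
# `BadPrimeGaussianMonoidsSyncProofs.lean` / `BadPrimeGaussianMonoidsSyncMonoidProofs.lean`)

S. Mochizuki, *Inter-universal Teichmüller theory II*, kurims Dec-2020 manuscript, Cor 3.5 (ii) p. 95 ("each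
`Ψ_ξ(M^Θ_*)` is equipped with a natural action by `G_v(M^Θ_*▶)_{⟨F_l^⋇⟩}` … the compatibility of the action of
`G_v(M^Θ_*▶)_{|t|}` … with the inclusions `G_v(M^Θ_*) ↪ Π_{v▶}(M^Θ_*▶)` determined by the various choices of the
`D^δ_{t,μ_-}` [cf. Corollary 2.8, (i), (ii)]"), Cor 2.4 (ii)(c) p. 70 ("a decomposition group `D^δ_{t,μ_-} ⊆ Π^δ_{v□̈}`
… i.e., the image of an evaluation section"), Prop 1.4 p. 27 ("`lim_J H¹(Π_Ÿ(Π)|_J, (l·Δ_Θ)(Π))` … where `J` ranges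
over the finite index open subgroups") [cite: Mochizuki2012, Cor 3.5 (ii) p.95]. Claim key DISPUTED (D-0012).
PROOF-ONLY companion (abc-iut cell, layer L6, seat abc-iut-w4-d004 gen 2; DISCHARGE-L6 §F row F1 continuation,
node **IUTchII:Cor3.5(ii)**, Galois clause; sub-DAG `plan/L6/SUBDAG-IUTchII-Cor-35.md` row Cor-35.ii.r10).
NO definition, NO `Prop` fact.

STATE OF THE NODE. The Galois clause is in the tree modulo exactly two NAMED junction hypotheses
(`BadPrimeGaussianMonoidsSyncProofs.map_pi_diagonalStable_of_kummer_of_fixed`, abc-iut-w4-d004;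
`BadPrimeGaussianMonoidsSyncMonoidProofs.mrange_pi_diagonalStable'_of_kummer_of_fixed`, abc-iut-w5-d100):
`hr` (equivariance of the restrictions along the sections `s_t`) and
`hfix : ∀ g t, E.conj (s t g) θ = θ` — in print: `D^δ_{t,μ_-} ⊆ Π_Ÿ(M^Θ_*)` (Cor 2.4 (ii)(c)) and inner
automorphisms of `Π_Ÿ` act trivially on `H¹(Π_Ÿ, −)`, the class `θ` (the orbit of `η̈^Θ`, a class defined over
`Ÿ`) living at the TOP level of the limit `lim_J H¹(Π_Ÿ|_J, −)`.

THIS FILE derives `hfix` at the MODEL of the ambient module used throughout the cell for [IUTchII] Prop 1.4 /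
Cor 1.12 / Prop 2.2 (abc-iut-L6-t1 `cohomologySystemOfContH1`, abc-iut-w4-d043 `CohomologyLimitConj`): the
direct limit `h1Lim φ A N ⊥ = lim_K H¹(N ⊓ K, A)` over the finite-index open `K ≤ Π` of L2's continuous `H¹`
(`ContH1`), `N ⊴ Π` (`Π_Ÿ ⊴ Π`), with its conjugation ACTION `h1LimConj σ` (`σ ∈ Π`).
* `h1LimConj_toLim_top_eq_self_of_mem` — **elements of `N` fix every class of the top level
  `H1 ⊤ ≅ H¹(N, A)` in the limit** (from abc-iut-w4-d043's `toLim_h1TopConjEquiv` +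
  `h1TopConjEquiv_eq_self_of_mem`, i.e. L2's `ContH1.conj_eq_self_of_mem`). NOTE (honest): elements of `N` do
  NOT act trivially on the whole limit (at level `K` the action factors through `N/(N ⊓ K)` — this is the
  genuine Galois action on the constants `Ψ_cns ≅ O^▷_{F̄_v}`, whose Kummer classes live at deep levels); only
  top-level classes — the theta classes — are fixed, exactly as print uses it.
* `conj_eq_self_ofTopClass` — TRANSPORT to any `ThetaEnvData E` whose ambient module is identified with the
  model limit by an additive isomorphism `ψ : E.H ≃ lim` intertwining `E.conj x` with `h1LimConj (j x)` along a
  homomorphism `j : Π_X(M^Θ_*) → Π` (the model identification — a DATUM, as in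
  `TemperedThetaMonoidsModelProofs`): if the sections land in `N` (`j (s t g) ∈ N`, Cor 2.4 (ii)(c)) and `θ` is
  a top-level class, then `E.conj (s t g) θ = θ` — the hypothesis `hfix` HOLDS.
* `map_pi_diagonalStable_of_kummer_ofTopClass` (restrictions typed out of the ambient group, the
  `BadPrimeGaussianMonoidsSyncProofs` assembly) — **"each `Ψ_ξ(M^Θ_*)` is equipped with a natural action by
  `G_v(M^Θ_*▶)_{⟨F_l^⋇⟩}`" with `hfix` DISCHARGED**: residual named hypotheses = the Kummer data of Prop 3.1 (ii)
  (GAP-LEDGER G-w4d019-1, narrowed to the coefficient isomorphism), the sections agreeing modulo `Δ`, the model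
  identification `(j, ψ)`, the containment `j (s t g) ∈ N`, `θ` top-level, and the equivariance `hr`
  (functoriality of restriction along the sections — discharged in the sequel
  `BadPrimeGaussianMonoidsCohomologyModelProofs2.lean` over `CohomologyLimitComap`, together with the
  monoid-sourced assembly of record `…SyncMonoidProofs.mrange_pi_diagonalStable'_of_kummer_of_fixed`).

Nothing here asserts a disputed claim or takes a side on [IUTchIII] Cor 3.12; typed ≠ proved ≠ endorsed.
-/

namespace Literature.IUT.HodgeArakelov

namespace BadPrimeGaussianMonoids

open Literature.AnabelianGeometry.EtaleTheta CohomologySystemOfContH1 TemperedThetaMonoids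

universe u v w x

/-! ### 1. At the model: elements of `N` fix the top-level classes of `lim_K H¹(N ⊓ K, A)` -/

section Model

variable {P : TopGroup.{x}} {G' : Type x} [Group G'] [TopologicalSpace G'] [IsTopologicalGroup G']
  (φ : P →* G') (A : Subgroup G') [A.Normal] [IsMulCommutative A] (N : Subgroup P) [N.Normal]

/-- **Inner automorphisms by elements of `N = Π_Ÿ` fix the top-level classes** of
`lim_K H¹(N ⊓ K, A)`: for `σ ∈ N` and `x ∈ H1 ⊤ ≅ H¹(N ⊓ ⊤, A)`, `h1LimConj σ (toLim ⊤ x) = toLim ⊤ x` — the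
cohomological content of [IUTchII] Cor 3.5 (ii)'s `hfix` (with Cor 2.4 (ii)(c) `D^δ_{t,μ_-} ⊆ Π_Ÿ`).
[cite: NeukirchSchmidtWingberg2008, I §5] -/
theorem h1LimConj_toLim_top_eq_self_of_mem {σ : P} (hσ : σ ∈ N)
    (x : (cohomologySystemOfContH1 φ A N).H1 ⊤) :
    h1LimConj φ A N σ ((cohomologySystemOfContH1 φ A N).toLim ⊤ x) =
      (cohomologySystemOfContH1 φ A N).toLim ⊤ x := by
  rw [← h1LimConjEquiv_apply, ← toLim_h1TopConjEquiv, h1TopConjEquiv_eq_self_of_mem φ A N hσ]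

/-- The same for a class GIVEN as a member of the image of the top level.
[cite: NeukirchSchmidtWingberg2008, I §5] -/
theorem h1LimConj_eq_self_of_mem_range_toLim_top {σ : P} (hσ : σ ∈ N) {y : h1Lim φ A N ⊥}
    (hy : y ∈ Set.range ((cohomologySystemOfContH1 φ A N).toLim ⊤)) : h1LimConj φ A N σ y = y := by
  obtain ⟨x, rfl⟩ := hy
  exact h1LimConj_toLim_top_eq_self_of_mem φ A N hσ x

end Model

/-! ### 2. Transport to a `ThetaEnvData` identified with the model: `hfix` holds -/

section Transport

variable {Q : Type u} [Group Q] (E : TemperedThetaMonoids.ThetaEnvData.{u, v} Q)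
  {P : TopGroup.{x}} {G' : Type x} [Group G'] [TopologicalSpace G'] [IsTopologicalGroup G']
  (φ : P →* G') (A : Subgroup G') [A.Normal] [IsMulCommutative A] (N : Subgroup P) [N.Normal]
  (j : Q →* P) (ψ : Additive E.H ≃+ h1Lim φ A N ⊥)

/-- **IUTchII:Cor3.5(ii)**, the junction hypothesis `hfix` DERIVED: if the ambient module `E.H` of the
theta-environment data is identified (`ψ`, equivariantly along `j : Π_X(M^Θ_*) → Π`) with the model limit
`lim_K H¹(Π_Ÿ|_K, −)`, every element `p` of `Π_X(M^Θ_*)` landing in `Π_Ÿ` (`j p ∈ N`) FIXES every top-level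
class `θ` (the theta classes). [cite: Mochizuki2012, Cor 3.5 (ii) p.95] -/
theorem conj_eq_self_ofTopClass
    (hψ : ∀ (p : Q) (y : E.H), ψ (Additive.ofMul (E.conj p y)) = h1LimConj φ A N (j p) (ψ (Additive.ofMul y)))
    {p : Q} (hp : j p ∈ N) {θ : E.H}
    (hθ : ψ (Additive.ofMul θ) ∈ Set.range ((cohomologySystemOfContH1 φ A N).toLim ⊤)) :
    E.conj p θ = θ := by
  apply Additive.ofMul.injective
  apply ψ.injective
  rw [hψ]
  exact h1LimConj_eq_self_of_mem_range_toLim_top φ A N hp hθ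

/-- **IUTchII:Cor3.5(ii)** `hfix` for a family of sections `s_t : G_v → Π_X(M^Θ_*)` whose images lie in `Π_Ÿ`
(Cor 2.4 (ii)(c): `D^δ_{t,μ_-} ⊆ Π_Ÿ`): `E.conj (s t g) θ = θ` for a top-level class `θ`.
[cite: Mochizuki2012, Cor 3.5 (ii) p.95] -/
theorem conj_section_eq_self_ofTopClass
    (hψ : ∀ (p : Q) (y : E.H), ψ (Additive.ofMul (E.conj p y)) = h1LimConj φ A N (j p) (ψ (Additive.ofMul y)))
    {G : Type w} [Group G] {T : Type*} (s : T → (G →* Q)) (hsN : ∀ t g, j (s t g) ∈ N) {θ : E.H}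
    (hθ : ψ (Additive.ofMul θ) ∈ Set.range ((cohomologySystemOfContH1 φ A N).toLim ⊤)) :
    ∀ g t, E.conj (s t g) θ = θ :=
  fun g t => conj_eq_self_ofTopClass E φ A N j ψ hψ (hsN t g) hθ

end Transport

/-! ### 3. The Galois clause with `hfix` discharged -/

section Assembly

variable {S : ThetaSetting.{u}} (A : AbsTopMonoids S) (Pc : IsoClass S.PiX)
  (E : TemperedThetaMonoids.ThetaEnvData.{u, v} Pc.G) (κ : A.MTM Pc →* E.H)
  {G : Type w} [Group G] {T : Type*} {M : Type*} [CommMonoid M]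
  {P : TopGroup.{x}} {G' : Type x} [Group G'] [TopologicalSpace G'] [IsTopologicalGroup G']
  (φ : P →* G') (Am : Subgroup G') [Am.Normal] [IsMulCommutative Am] (N : Subgroup P) [N.Normal]
  (j : Pc.G →* P) (ψ : Additive E.H ≃+ h1Lim φ Am N ⊥)

/-- **IUTchII:Cor3.5(ii)** (kurims p.95) "each `Ψ_ξ(M^Θ_*)` is equipped with a natural action by
`G_v(M^Θ_*▶)_{⟨F_l^⋇⟩}`" (abc-iut-w4-d004 `map_pi_diagonalStable_of_kummer_of_fixed`, restrictions typed out of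
the ambient group `E.H`), with the junction hypothesis `hfix` DISCHARGED at the cohomology model: hypotheses =
(a) the Kummer data of Prop 3.1 (ii) (G-w4d019-1), (b) sections `s_t` agreeing modulo `Δ`, (c) the model
identification `ψ : E.H ≃ lim_K H¹(Π_Ÿ|_K, −)` equivariant along `j`, (d) `j (s t g) ∈ Π_Ÿ` (Cor 2.4 (ii)(c)),
(e) `θ` a top-level class, (f) the equivariance `hr`. [cite: Mochizuki2012, Cor 3.5 (ii) p.95] -/
theorem map_pi_diagonalStable_of_kummer_ofTopClass (hκ : Function.Injective κ)
    (hcns : E.constantMonoid = MonoidHom.mrange κ)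
    (hκeq : ∀ (x : Pc.G) (m : A.MTM Pc), κ (A.actMTM Pc x m) = E.conj x (κ m)) (s : T → (G →* Pc.G))
    (hs : ∀ t t' g, (QuotientGroup.mk (s t g) : Pc.G ⧸ A.Delta Pc) = QuotientGroup.mk (s t' g))
    (hψ : ∀ (p : Pc.G) (y : E.H),
      ψ (Additive.ofMul (E.conj p y)) = h1LimConj φ Am N (j p) (ψ (Additive.ofMul y)))
    (hsN : ∀ t g, j (s t g) ∈ N) (β : G →* MulAut M) (r : T → (E.H →* M))
    (hr : ∀ t g x, r t (E.conj (s t g) x) = β g (r t x)) (θ : E.H)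
    (hθ : ψ (Additive.ofMul θ) ∈ Set.range ((cohomologySystemOfContH1 φ Am N).toLim ⊤)) (t₀ : T) (g : G) :
    ((splitMonoid E.units (Submonoid.powers θ)).map (MonoidHom.pi r)).map (piIso T (β g)).toMonoidHom =
      (splitMonoid E.units (Submonoid.powers θ)).map (MonoidHom.pi r) :=
  map_pi_diagonalStable_of_kummer_of_fixed A Pc E κ hκ hcns hκeq s hs β r hr θ
    (conj_section_eq_self_ofTopClass E φ Am N j ψ hψ s hsN hθ) t₀ g

end Assembly

end BadPrimeGaussianMonoids

end Literature.IUT.HodgeArakelov
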